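import Literature.Geometry.Riemannian.HuiskenMonotonicity
import Literature.Geometry.Riemannian.SphericalCylinderEntropy
import Literature.Geometry.Manifold.CylinderSlice
import HarnessLib

/-!
# Hamilton's monotonicity along a smooth cylinder flow, part 2: orthonormal frames of a
# cross-section of `N = S⁴ × ℝ ⊂ ℝ⁶` and the mean curvature of the radial normal

Part 2 of the proof of the registered stub `stub_hamiltonMonotonicity` of line `killing-flux` of the
crux `CylinderEntropy.CylinderRungTwo` (stmt-SmoothPoincare4-7631). A cross-section `f : M → N` of the
round cylinder `N = {z ∈ ℝ⁶ | |z'| = 1}` is a submanifold of codimension TWO of `ℝ⁶`, with normal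
frame `{ν, n}`: `ν` the unit normal of `f(M)` inside `N` and `n = (z', 0)` the radial unit normal of
`N`. This file supplies the pointwise linear algebra and the extrinsic geometry of `n` used to turn
the Green identity `∫_Σ Δ_Σ(φ|_Σ) = 0` (part 3) into ambient terms:

* `orthonormal_mfderiv_frame'` — images of an `f^*δ`-orthonormal frame are orthonormal in the
  ambient space (any codimension; the tree's `orthonormal_mfderiv_frame` is typed for hypersurfaces);
* `inner_padL_left`, `inner_truncL_truncL`, `inner_padL_truncL_left`, `truncL_padL`,
  `sum_inner_truncL_single` (`Σⱼ |T eⱼ|² = 5`, `T` = drop the last coordinate) — coordinate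
  bookkeeping for `n = padL (truncL z)`;
* `isUnitNormal_radial` — **`n ∘ f` is a unit normal field along every smooth map into `N`**
  (differentiate `|T f(c(s))|² = 1` along chart curves);
* `sum_apply_orthonormalBasis_eq` — the sum `Σᵢ B(bᵢ, bᵢ)` of a bilinear form over an orthonormal
  basis does not depend on the basis; `sum_frame_add_eq_sum_single` — for an orthonormal tangent
  frame `e` of the cross-section, `Σᵢ B(eᵢ,eᵢ) + B(ν,ν) + B(n,n) = Σⱼ B(eⱼ⁰,eⱼ⁰)` over the
  standard basis of `ℝ⁶` (`{eᵢ} ∪ {ν, n}` is an orthonormal basis of `ℝ⁶`);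
* `meanCurvature_radial_eq` — **the mean curvature of the cross-section with respect to the radial
  normal is `H_n = 4 - |ν'|²`** (`K_n(u, u) = |T df u|²`, so `H_n = Σᵢ |T eᵢ|² = 5 - |Tν|² - |Tn|²`);
* `stub_hamiltonMonotonicity_part2` — the registered sub-goal marker (the last statement).

Everything is PROVED (no `sorry`, no new definitions, no named facts).

References: B. O'Neill, *Semi-Riemannian Geometry* (1983), Ch. 4, Lemma 4 and pp. 97–100;
R. S. Hamilton, *Monotonicity formulas for parabolic flows on manifolds*, Comm. Anal. Geom. 1 (1993)
127–137, §4.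
-/

-- the prescribed namespace `Summit.SmoothPoincare4.SmoothPoincare4.…` repeats `SmoothPoincare4`
set_option linter.dupNamespace false

noncomputable section

open Bundle Set Function Filter MeasureTheory Module
open scoped Manifold ContDiff Topology RealInnerProductSpace BigOperators

namespace Summit.SmoothPoincare4.SmoothPoincare4.Cruxes.CylinderRungTwo.KillingFlux

open Literature.Geometry.Riemannian Literature.Geometry.Riemannian.EuclideanHypersurface
open Literature.Geometry.Lorentzian Literature.Geometry.Lorentzian.PseudoRiemannianMetric
open Literature.Geometry.Riemannian.SphericalCylinderEntropy (truncL truncL_apply)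
open Literature.Geometry.Manifold.CylinderSlice (padL padL_apply_castSucc padL_apply_last)

section Frame

variable {m : ℕ} {M : Type*} [TopologicalSpace M] [ChartedSpace (EuclideanSpace ℝ (Fin m)) M]
  [IsManifold (𝓡 m) ∞ M] {W : Type*} [NormedAddCommGroup W] [InnerProductSpace ℝ W]

/-- **Images of an orthonormal frame are orthonormal** (any codimension): if `b` is an
`f^*δ`-orthonormal frame of `T_w M` then `(df bᵢ)` is an orthonormal family of the ambient Euclidean
space. [folklore] -/
theorem orthonormal_mfderiv_frame' {f : M → W}
    (hf : (euclideanMetric W).IsSpacelikeImmersion (𝓡 m) f) (w : M)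
    {ι : Type*} [Fintype ι] {b : ι → TangentSpace (𝓡 m) w}
    (hb : ((euclideanMetric W).inducedMetric f contMDiff_pullbackBilin_holds hf).IsOrthonormalFrame w b) :
    Orthonormal ℝ (fun i => (show W from
      (mfderiv (𝓡 m) 𝓘(ℝ, W) f w : TangentSpace (𝓡 m) w →L[ℝ] W) (b i))) := by
  classical
  rw [orthonormal_iff_ite]
  intro i j
  have hval : ∀ u v : TangentSpace (𝓡 m) w, ((euclideanMetric W).inducedMetric f
      contMDiff_pullbackBilin_holds hf).val w u v =
      ⟪(mfderiv (𝓡 m) 𝓘(ℝ, W) f w : TangentSpace (𝓡 m) w →L[ℝ] W) u,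
       (mfderiv (𝓡 m) 𝓘(ℝ, W) f w : TangentSpace (𝓡 m) w →L[ℝ] W) v⟫ := fun u v => by
    rw [inducedMetric_val, inducedBilin_apply, euclideanMetric_apply]
  split_ifs with hij
  · subst hij
    exact (hval (b i) (b i)).symm.trans (hb.1 i)
  · exact (hval (b i) (b j)).symm.trans (hb.2 i j hij)

end Frame

section Radial

variable {M : Type*} [TopologicalSpace M] [ChartedSpace (EuclideanSpace ℝ (Fin 4)) M]
  [IsManifold (𝓡 4) ∞ M]

/-- `⟪padL a, v⟫ = ∑_{i<5} aᵢ vᵢ` (`padL a = (a, 0)`). [folklore] -/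
theorem inner_padL_left (a : EuclideanSpace ℝ (Fin 5)) (v : EuclideanSpace ℝ (Fin 6)) :
    ⟪padL a, v⟫ = ∑ i : Fin 5, a i * v (Fin.castSucc i) := by
  simp only [PiLp.inner_apply, RCLike.inner_apply, conj_trivial]
  rw [Fin.sum_univ_castSucc]
  simp only [padL_apply_castSucc, show (Fin.last 5 : Fin 6) = 5 from rfl, padL_apply_last,
    mul_zero, add_zero]
  exact Finset.sum_congr rfl fun i _ => mul_comm _ _

/-- `⟪truncL u, truncL v⟫ = ∑_{i<5} uᵢ vᵢ`. [folklore] -/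
theorem inner_truncL_truncL (u v : EuclideanSpace ℝ (Fin 6)) :
    ⟪truncL u, truncL v⟫ = ∑ i : Fin 5, u (Fin.castSucc i) * v (Fin.castSucc i) := by
  simp only [PiLp.inner_apply, RCLike.inner_apply, conj_trivial, truncL_apply]
  exact Finset.sum_congr rfl fun i _ => mul_comm _ _

/-- `⟪padL (truncL z), v⟫ = ∑_{i<5} zᵢ vᵢ`: the radial field `n = (z', 0)` pairs through the first
five coordinates. [folklore] -/
theorem inner_padL_truncL_left (z v : EuclideanSpace ℝ (Fin 6)) :
    ⟪padL (truncL z), v⟫ = ∑ i : Fin 5, z (Fin.castSucc i) * v (Fin.castSucc i) := by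
  rw [inner_padL_left]
  simp only [truncL_apply]


/-- `truncL (padL a) = a`. [folklore] -/
theorem truncL_padL (a : EuclideanSpace ℝ (Fin 5)) : truncL (padL a) = a := by
  ext i
  rw [truncL_apply, padL_apply_castSucc]

/-- `truncL eⱼ = eⱼ` for the first five standard basis vectors. [folklore] -/
theorem truncL_single_castSucc (j : Fin 5) :
    truncL (EuclideanSpace.single (Fin.castSucc j) (1 : ℝ)) = EuclideanSpace.single j (1 : ℝ) := by
  ext i
  rw [truncL_apply]
  by_cases h : i = j
  · subst h; simp
  · have h' : (Fin.castSucc i : Fin 6) ≠ Fin.castSucc j := fun e => h (Fin.castSucc_injective _ e)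
    simp [h, h']

/-- `truncL e₅ = 0`. [folklore] -/
theorem truncL_single_last :
    truncL (EuclideanSpace.single (Fin.last 5) (1 : ℝ)) = 0 := by
  ext i
  rw [truncL_apply]
  have h' : (Fin.castSucc i : Fin 6) ≠ 5 := by
    rw [show (5 : Fin 6) = Fin.last 5 from rfl]; exact Fin.castSucc_ne_last i
  simp [h']

/-- `Σⱼ |truncL eⱼ|² = 5` over the standard basis of `ℝ⁶` (the trace of the orthogonal projection
onto the first five coordinates). [folklore] -/
theorem sum_inner_truncL_single :
    ∑ j : Fin 6, ⟪truncL (EuclideanSpace.single j (1 : ℝ)), truncL (EuclideanSpace.single j (1 : ℝ))⟫ = 5 := by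
  rw [Fin.sum_univ_castSucc]
  simp only [truncL_single_castSucc, truncL_single_last, inner_zero_left, add_zero,
    EuclideanSpace.inner_single_left, map_one, one_mul]
  simp

/-- Derivative of `s ↦ |T β(s)|²` along a differentiable curve `β` of `ℝ⁶` (`T` = drop the last
coordinate). [folklore] -/
theorem hasDerivAt_inner_truncL_comp {β : ℝ → EuclideanSpace ℝ (Fin 6)} {β' : EuclideanSpace ℝ (Fin 6)}
    {s : ℝ} (hβ : HasDerivAt β β' s) :
    HasDerivAt (fun s => ⟪truncL (β s), truncL (β s)⟫) (⟪truncL (β s), truncL β'⟫ + ⟪truncL β', truncL (β s)⟫) s := by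
  have hT : HasDerivAt (fun s => truncL (β s)) (truncL β') s :=
    truncL.hasFDerivAt.comp_hasDerivAt s hβ
  exact hT.inner ℝ hT

/-- **The radial field `n = (z', 0)` is a unit normal field along every smooth map into
`N = S⁴ × ℝ`**: `⟪n(f y), df_y v⟫ = 0` (differentiate `|T f(c_v(s))|² ≡ 1` along the chart curve
`c_v` through `y`, `hasDerivAt_comp_curveThrough_zero`) and `|n(f y)|² = |f(y)'|² = 1`. This is the
unit normal of the hypersurface `N ⊂ ℝ⁶` restricted to the cross-section. [folklore] -/
theorem isUnitNormal_radial {f : M → EuclideanSpace ℝ (Fin 6)}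
    (hf : ContMDiff (𝓡 4) 𝓘(ℝ, EuclideanSpace ℝ (Fin 6)) ∞ f)
    (hN : ∀ x, ∑ i : Fin 5, f x (Fin.castSucc i) ^ 2 = 1) :
    (euclideanMetric (EuclideanSpace ℝ (Fin 6))).IsUnitNormal (𝓡 4) f
      (fun w => padL (truncL (f w))) 1 := by
  refine ⟨fun y v => ?_, fun y => ?_⟩
  · rw [euclideanMetric_apply]
    show ⟪padL (truncL (f y)), (mfderiv (𝓡 4) 𝓘(ℝ, EuclideanSpace ℝ (Fin 6)) f y :
      TangentSpace (𝓡 4) y →L[ℝ] EuclideanSpace ℝ (Fin 6)) v⟫ = 0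
    set β : ℝ → EuclideanSpace ℝ (Fin 6) := f ∘ curveThrough (𝓡 4) y v with hβ
    have hβd : HasDerivAt β ((mfderiv (𝓡 4) 𝓘(ℝ, EuclideanSpace ℝ (Fin 6)) f y :
        TangentSpace (𝓡 4) y →L[ℝ] EuclideanSpace ℝ (Fin 6)) v) 0 :=
      hasDerivAt_comp_curveThrough_zero hf y v
    have hq := hasDerivAt_inner_truncL_comp hβd
    have hconst : (fun s => ⟪truncL (β s), truncL (β s)⟫) = fun _ => (1 : ℝ) := by
      funext s
      rw [inner_truncL_truncL]
      have := hN (curveThrough (𝓡 4) y v s)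
      simpa only [hβ, Function.comp_apply, sq] using this
    rw [hconst] at hq
    have h0 := (hasDerivAt_const (0 : ℝ) (1 : ℝ)).unique hq
    have hβ0 : β 0 = f y := by simp [hβ, curveThrough_zero]
    rw [hβ0, real_inner_comm (truncL (f y)), ← two_mul] at h0
    rw [inner_padL_left]
    have h1 := ((mul_right_inj' (two_ne_zero' ℝ)).1 (h0.symm.trans (mul_zero (2 : ℝ)).symm))
    rw [inner_truncL_truncL] at h1
    simpa only [truncL_apply] using h1
  · rw [euclideanMetric_apply]
    show ⟪padL (truncL (f y)), padL (truncL (f y))⟫ = 1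
    rw [inner_padL_truncL_left]
    simp only [padL_apply_castSucc, truncL_apply]
    simpa only [sq] using hN y

end Radial

section OrthonormalSums

/-- **The trace of a bilinear form does not depend on the orthonormal basis**: for orthonormal bases
`b, b'` of a real inner product space and a continuous bilinear form `B`,
`Σᵢ B(bᵢ, bᵢ) = Σⱼ B(b'ⱼ, b'ⱼ)` (expand `bᵢ` in `b'` in the first slot, swap the sums and
re-assemble `b'ⱼ = Σᵢ ⟪bᵢ, b'ⱼ⟫ bᵢ` in the second slot). [folklore] -/
theorem sum_apply_orthonormalBasis_eq {V : Type*} [NormedAddCommGroup V] [InnerProductSpace ℝ V]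
    {ι ι' : Type*} [Fintype ι] [Fintype ι'] (b : OrthonormalBasis ι ℝ V)
    (b' : OrthonormalBasis ι' ℝ V) (B : V →L[ℝ] V →L[ℝ] ℝ) :
    ∑ i, B (b i) (b i) = ∑ j, B (b' j) (b' j) := by
  have hstep : ∀ i, B (b i) (b i) = ∑ j, ⟪b' j, b i⟫ * B (b' j) (b i) := by
    intro i
    have h1 : B (b i) = ∑ j, ⟪b' j, b i⟫ • B (b' j) := by
      have := congrArg B (b'.sum_repr' (b i)).symm
      rw [map_sum] at this
      simpa only [map_smul] using this
    have h1' := congrArg (fun L : V →L[ℝ] ℝ => L (b i)) h1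
    simpa only [FunLike.coe_sum, FunLike.coe_smul, Finset.sum_apply,
      Pi.smul_apply, smul_eq_mul] using h1'
  rw [Finset.sum_congr rfl fun i _ => hstep i, Finset.sum_comm]
  refine Finset.sum_congr rfl fun j _ => ?_
  have h2 : ∑ i, ⟪b' j, b i⟫ * B (b' j) (b i) = B (b' j) (∑ i, ⟪b i, b' j⟫ • b i) := by
    rw [map_sum]
    refine Finset.sum_congr rfl fun i _ => ?_
    rw [map_smul, smul_eq_mul, real_inner_comm]
  rw [h2, b.sum_repr']

/-- **Completing a tangent frame of a cross-section to an orthonormal basis of `ℝ⁶`**: for an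
orthonormal family `e₀, …, e₃` of `ℝ⁶` and unit vectors `ν, n` orthogonal to it and to each other,
`{eᵢ} ∪ {ν, n}` is an orthonormal basis of `ℝ⁶` (six orthonormal vectors), so for every continuous
bilinear form `B`, `Σᵢ B(eᵢ, eᵢ) + B(ν, ν) + B(n, n) = Σⱼ B(eⱼ⁰, eⱼ⁰)` over the standard basis
(`sum_apply_orthonormalBasis_eq`). [folklore] -/
theorem sum_frame_add_eq_sum_single {e : Fin 4 → EuclideanSpace ℝ (Fin 6)} (he : Orthonormal ℝ e)
    {ν n : EuclideanSpace ℝ (Fin 6)} (hν : ‖ν‖ = 1) (hn : ‖n‖ = 1)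
    (hνe : ∀ i, ⟪ν, e i⟫ = 0) (hne : ∀ i, ⟪n, e i⟫ = 0) (hνn : ⟪ν, n⟫ = 0)
    (B : EuclideanSpace ℝ (Fin 6) →L[ℝ] EuclideanSpace ℝ (Fin 6) →L[ℝ] ℝ) :
    ∑ i, B (e i) (e i) + B ν ν + B n n =
      ∑ j : Fin 6, B (EuclideanSpace.single j (1 : ℝ)) (EuclideanSpace.single j (1 : ℝ)) := by
  set v : Fin 4 ⊕ Fin 2 → EuclideanSpace ℝ (Fin 6) := Sum.elim e ![ν, n] with hvdef
  have hv : Orthonormal ℝ v := by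
    classical
    rw [orthonormal_iff_ite]
    have he' := orthonormal_iff_ite.1 he
    rintro (i | k) (j | l)
    · simp only [hvdef, Sum.elim_inl, Sum.inl.injEq]
      exact he' i j
    · have h0 : ⟪e i, (![ν, n] : Fin 2 → EuclideanSpace ℝ (Fin 6)) l⟫ = 0 := by
        fin_cases l
        · simpa [real_inner_comm] using hνe i
        · simpa [real_inner_comm] using hne i
      simpa [hvdef] using h0
    · have h0 : ⟪(![ν, n] : Fin 2 → EuclideanSpace ℝ (Fin 6)) k, e j⟫ = 0 := by
        fin_cases k
        · simpa using hνe j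
        · simpa using hne j
      simpa [hvdef] using h0
    · have hnν : ⟪n, ν⟫ = 0 := by rw [real_inner_comm]; exact hνn
      fin_cases k <;> fin_cases l <;> simp [hvdef, hν, hn, hνn, hnν]
  have hcard : Fintype.card (Fin 4 ⊕ Fin 2) = finrank ℝ (EuclideanSpace ℝ (Fin 6)) := by
    rw [finrank_euclideanSpace, Fintype.card_sum, Fintype.card_fin, Fintype.card_fin,
      Fintype.card_fin]
  set b6 : OrthonormalBasis (Fin 4 ⊕ Fin 2) ℝ (EuclideanSpace ℝ (Fin 6)) :=
    (basisOfOrthonormalOfCardEqFinrank hv hcard).toOrthonormalBasis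
      (by rw [coe_basisOfOrthonormalOfCardEqFinrank]; exact hv) with hb6def
  have hb6 : ∀ s, b6 s = v s := fun s => by
    rw [hb6def, Module.Basis.coe_toOrthonormalBasis, coe_basisOfOrthonormalOfCardEqFinrank]
  have key := sum_apply_orthonormalBasis_eq b6 (EuclideanSpace.basisFun (Fin 6) ℝ) B
  simp only [hb6, EuclideanSpace.basisFun_apply, Fintype.sum_sum_type, Fin.sum_univ_two,
    hvdef, Sum.elim_inl, Sum.elim_inr, Matrix.cons_val_zero, Matrix.cons_val_one] at key
  rw [← key]
  ring

end OrthonormalSums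

section SliceGeometry

variable {M : Type*} [TopologicalSpace M] [ChartedSpace (EuclideanSpace ℝ (Fin 4)) M]
  [IsManifold (𝓡 4) ∞ M]

/-- **The mean curvature of a cross-section of `N = S⁴ × ℝ` with respect to the radial normal is
`H_n = 4 - |ν'|²`.** For a Riemannian immersion `f : M⁴ → ℝ⁶` with image in `N`, unit normal `ν`
tangent to `N`, and the radial unit normal `n = (z', 0) ∘ f` (tree conventions
`K_n(v, w) = ⟪D_v n, df w⟫`, `H_n = tr_{f^*δ} K_n`): `D_v n = T^*T df v` (`n = P ∘ f`, `P` the linear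
projection onto the first five coordinates), so on an `f^*δ`-orthonormal frame
`H_n = Σᵢ |T eᵢ|² = tr P - |Tν|² - |Tn|² = 5 - |ν'|² - 1` (`sum_frame_add_eq_sum_single`). This is
the trace on `TΣ` of the second fundamental form of the hypersurface `N ⊂ ℝ⁶` (principal curvatures
`1, 1, 1, 1, 0`), the correction term between `Δ_N` and `Δ_{ℝ⁶}` in Hamilton's computation.
[cite: ONeill1983, Ch. 4, Lemma 4 and pp. 97–100] -/
theorem meanCurvature_radial_eq {f νf : M → EuclideanSpace ℝ (Fin 6)}
    (hf : (euclideanMetric (EuclideanSpace ℝ (Fin 6))).IsSpacelikeImmersion (𝓡 4) f)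
    (hun : (euclideanMetric (EuclideanSpace ℝ (Fin 6))).IsUnitNormal (𝓡 4) f νf 1)
    (hN : ∀ x, ∑ i : Fin 5, f x (Fin.castSucc i) ^ 2 = 1)
    (hνN : ∀ x, ∑ i : Fin 5, νf x (Fin.castSucc i) * f x (Fin.castSucc i) = 0) (w : M) :
    (euclideanMetric (EuclideanSpace ℝ (Fin 6))).meanCurvature f contMDiff_pullbackBilin_holds hf
        (fun y => padL (truncL (f y))) w = 4 - ∑ i : Fin 5, νf w (Fin.castSucc i) ^ 2 := by
  set g₁ := (euclideanMetric (EuclideanSpace ℝ (Fin 6))).inducedMetric f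
    contMDiff_pullbackBilin_holds hf with hg₁
  set A : TangentSpace (𝓡 4) w →L[ℝ] EuclideanSpace ℝ (Fin 6) :=
    mfderiv (𝓡 4) 𝓘(ℝ, EuclideanSpace ℝ (Fin 6)) f w with hA
  have hfs : ContMDiff (𝓡 4) 𝓘(ℝ, EuclideanSpace ℝ (Fin 6)) ∞ f := hf.contMDiff_self
  have hrad := isUnitNormal_radial hfs hN
  -- the radial field is `P ∘ f`, `P = padL ∘ truncL` linear
  have hns : ContMDiff (𝓡 4) 𝓘(ℝ, EuclideanSpace ℝ (Fin 6)) ∞ (fun y => padL (truncL (f y))) :=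
    (padL.comp truncL).contDiff.comp_contMDiff hfs
  have hnd : ∀ u : TangentSpace (𝓡 4) w,
      (mfderiv (𝓡 4) 𝓘(ℝ, EuclideanSpace ℝ (Fin 6)) (fun y => padL (truncL (f y))) w :
        TangentSpace (𝓡 4) w →L[ℝ] EuclideanSpace ℝ (Fin 6)) u = padL (truncL (A u)) := by
    intro u
    have h1 : HasMFDerivAt (𝓡 4) 𝓘(ℝ, EuclideanSpace ℝ (Fin 6)) f w A :=
      ((hfs w).mdifferentiableAt (by simp)).hasMFDerivAt
    have h2 := ((padL.comp truncL).hasFDerivAt (x := f w)).hasMFDerivAt.comp w h1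
    have h3 : mfderiv (𝓡 4) 𝓘(ℝ, EuclideanSpace ℝ (Fin 6)) (fun y => padL (truncL (f y))) w =
        (padL.comp truncL).comp A := h2.mfderiv
    rw [h3]
    rfl
  -- an orthonormal frame
  have hpos : ∀ u : TangentSpace (𝓡 4) w, u ≠ 0 → 0 < g₁.val w u u :=
    fun u hu => isRiemannian_inducedMetric _ _ contMDiff_pullbackBilin_holds hf w u hu
  haveI : FiniteDimensional ℝ (TangentSpace (𝓡 4) w) :=
    inferInstanceAs (FiniteDimensional ℝ (EuclideanSpace ℝ (Fin 4)))
  obtain ⟨b, hb⟩ := g₁.exists_basis_isOrthonormalFrame hpos (m := 4)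
    (by exact finrank_euclideanSpace_fin)
  set e : Fin 4 → EuclideanSpace ℝ (Fin 6) := fun i => A (b i) with he
  have hon : Orthonormal ℝ e := orthonormal_mfderiv_frame' hf w hb
  -- the trace on the frame
  rw [meanCurvature, g₁.trace_eq_sum_of_isOrthonormalFrame b hb]
  have hK : ∀ i, (euclideanMetric (EuclideanSpace ℝ (Fin 6))).secondFundamentalForm (𝓡 4) f
      (fun y => padL (truncL (f y))) w (b i) (b i) = ⟪truncL (e i), truncL (e i)⟫ := by
    intro i
    rw [secondFundamentalForm_eq_inner hfs hns w (b i) (b i), hnd]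
    exact (inner_padL_truncL_left (A (b i)) (A (b i))).trans (inner_truncL_truncL (e i) (e i)).symm
  simp only [hK]
  -- `Σᵢ |eᵢ'|² + |ν'|² + |n'|² = 5`
  set B : EuclideanSpace ℝ (Fin 6) →L[ℝ] EuclideanSpace ℝ (Fin 6) →L[ℝ] ℝ :=
    (innerSL ℝ).bilinearComp (truncL : EuclideanSpace ℝ (Fin 6) →L[ℝ] EuclideanSpace ℝ (Fin 5))
      (truncL : EuclideanSpace ℝ (Fin 6) →L[ℝ] EuclideanSpace ℝ (Fin 5)) with hBdef
  have hB : ∀ u v, B u v = ⟪truncL u, truncL v⟫ := fun u v => by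
    rw [hBdef, ContinuousLinearMap.bilinearComp_apply, innerSL_apply_apply]
  have hνunit : ‖νf w‖ = 1 := by
    have h : ⟪νf w, νf w⟫ = (1 : ℝ) := by
      have := hun.val_self w
      rwa [euclideanMetric_apply] at this
    rw [real_inner_self_eq_norm_sq] at h
    nlinarith [norm_nonneg (νf w)]
  have hnunit : ‖padL (truncL (f w))‖ = 1 := by
    have h : ⟪padL (truncL (f w)), padL (truncL (f w))⟫ = (1 : ℝ) := by
      have := hrad.val_self w
      rwa [euclideanMetric_apply] at this
    rw [real_inner_self_eq_norm_sq] at h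
    nlinarith [norm_nonneg (padL (truncL (f w)))]
  have hνe : ∀ i, ⟪νf w, e i⟫ = 0 := fun i => by
    have := hun.isNormalTo w (b i)
    rwa [euclideanMetric_apply] at this
  have hne : ∀ i, ⟪padL (truncL (f w)), e i⟫ = 0 := fun i => by
    have := hrad.isNormalTo w (b i)
    rwa [euclideanMetric_apply] at this
  have hνn : ⟪νf w, padL (truncL (f w))⟫ = 0 := by
    rw [real_inner_comm, inner_padL_truncL_left]
    simpa only [mul_comm] using hνN w
  have key := sum_frame_add_eq_sum_single hon hνunit hnunit hνe hne hνn B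
  simp only [hB] at key
  rw [sum_inner_truncL_single, truncL_padL, inner_truncL_truncL, inner_truncL_truncL] at key
  have h1 : ∑ i : Fin 5, f w (Fin.castSucc i) * f w (Fin.castSucc i) = 1 := by
    simpa only [sq] using hN w
  have h2 : ∑ i : Fin 5, νf w (Fin.castSucc i) * νf w (Fin.castSucc i) =
      ∑ i : Fin 5, νf w (Fin.castSucc i) ^ 2 := Finset.sum_congr rfl fun i _ => by ring
  rw [h1, h2] at key
  linarith

end SliceGeometry

/-- **Registered sub-goal marker `stub_hamiltonMonotonicity_part2` (the mean curvature of a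
cross-section of `N = S⁴ × ℝ` with respect to the radial normal).** For a Riemannian immersion
`f : M⁴ → ℝ⁶` with image in `N`, a unit normal `ν` of `f` tangent to `N`, and every `w ∈ M`:
`H_n(w) = 4 - |ν(w)'|²`, `n = (z', 0) ∘ f` the radial normal (`meanCurvature_radial_eq`).
[cite: ONeill1983, Ch. 4, Lemma 4 and pp. 97–100] -/
theorem stub_hamiltonMonotonicity_part2 :
    ∀ (M : Type) [TopologicalSpace M] [ChartedSpace (EuclideanSpace ℝ (Fin 4)) M] [IsManifold (𝓡 4) ∞ M] (f νf : M → EuclideanSpace ℝ (Fin 6)) (hf : (Literature.Geometry.Riemannian.euclideanMetric (EuclideanSpace ℝ (Fin 6))).IsSpacelikeImmersion (𝓡 4) f), (Literature.Geometry.Riemannian.euclideanMetric (EuclideanSpace ℝ (Fin 6))).IsUnitNormal (𝓡 4) f νf 1 → (∀ x, ∑ i : Fin 5, f x (Fin.castSucc i) ^ 2 = 1) → (∀ x, ∑ i : Fin 5, νf x (Fin.castSucc i) * f x (Fin.castSucc i) = 0) → ∀ w : M, (Literature.Geometry.Riemannian.euclideanMetric (EuclideanSpace ℝ (Fin 6))).meanCurvature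 f Literature.Geometry.Lorentzian.PseudoRiemannianMetric.contMDiff_pullbackBilin_holds hf (fun y => Literature.Geometry.Manifold.CylinderSlice.padL (Literature.Geometry.Riemannian.SphericalCylinderEntropy.truncL (f y))) w = 4 - ∑ i : Fin 5, νf w (Fin.castSucc i) ^ 2 :=
  fun _ _ _ _ _ _ hf hun hN hνN w => meanCurvature_radial_eq hf hun hN hνN w

end Summit.SmoothPoincare4.SmoothPoincare4.Cruxes.CylinderRungTwo.KillingFlux

end
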